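import Mathlib
import HarnessLib
import HarnessLib.Audit
import Summits.AtomisticToContinuum.Statement
import Literature.MathematicalPhysics.QuantumManyBody.PeriodicBoseGas
import HarnessLib.Audit.Status.Attr

/-!
Route: BECDistantTilts

DORMANT since 2026-08-29T19:27:21Z (census g0: costume|duplicate of —; reader census-reader-34-g0) — unstaffed, not closed; items shared with open routes are served there. `ledger route dormant <id> --off` reactivates.

# Route BECDistantTilts — Dirichlet BEC from torus BEC by commuting two distant tilts (walls vs
tagged boson) of the positive ground-state measure

It suffices to show X = TiltCommutation ∧ BulkIndistinguishability ∧ PeriodicBEC (card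
bc-transfer-influence-factorisation; conforming
re-opening of the retired gen-1 route BECTiltCommutation, whose only defect was formal: no deciding
theorem). PeriodicBEC (shared verbatim with
stmt-AtomisticToContinuum-0826) is the only OFF-DIAGONAL input and lives on the torus of the same
side L = (N/ρ)^{1/3}; the two new cruxes are
DIAGONAL statements about the positive measures |Ψ_D|² (Dirichlet box) and |Ψ_P|² (torus): (C1)
TiltCommutation — the Palm law of |Ψ_D|² at a
point x equals the tilt of the Dirichlet (N−1)-marginal by the PERIODIC insertion (Papangelou)
weight, in density-weighted mean total variation
o(N): wall tilt and tag tilt commute; (C2) BulkIndistinguishability — the two-point insertion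
affinities of the wall-tilted environment dominate
the torus Palm affinities up to o(N²) in ρ⊗ρ-weighted mean. Since for a positive wave function
γ(x,y) = √(ρ₁(x)ρ₁(y))·BC(P_x,P_y) is a functional
of the diagonal measure, C1 ∧ C2 turn torus ODLRO into occupation ≥ cN of the Dirichlet ground
state's own density mode √(ρ_Φ/N) (supports
PairAlgebra, TorusAveraging), and near-minimiser compactness + Perron–Frobenius (support
GroundStateReduction) give HasGroundStateBEC per potential.
Lean: `TiltCommutation ∧ BulkIndistinguishability ∧ PeriodicBEC`

## Assembly
Quantifier bookkeeping only, PROVED (glue.lean / Sketch.lean `closes`, lean check rc 0, axioms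
propext · Classical.choice · Quot.sound): fix v
repulsive finite-range and apply GroundStateReduction v; its hypothesis (Dirichlet ground-state
coherence of the density mode) is produced as follows —
ρ₀ = min of the thresholds of TiltCommutation, BulkIndistinguishability and TorusAveraging v
(PeriodicBEC v); for ρ < ρ₀ get c > 0 from TorusAveraging,
put c' = min c 1, η = (c'/16)² (so c − 4η − 4√η ≥ c'/2), intersect the three eventually-sets
(filter_upwards); for a Dirichlet ground state Φ take
the periodic ground state Θ supplied by TorusAveraging, feed the C1 and C2 inequalities for (Φ, Θ)
and the coherence inequality into PairAlgebra
(its measurability / support / normalisation hypotheses are conjuncts of the ground-state predicate)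
and read off Q(Φ) ≥ (c'/2)·N. The same proof with
the PeriodicBEC body as a hypothesis gives stmt-0827 BoundaryTransferWeak per v (theorem `transfer`,
not filed). Items at open: 7 (3 cruxes, 3 support,
1 assembly).

Rationale: WHY THIS LINE. Energy comparison cannot transfer condensation between boundary conditions at the
thermodynamic box (wall energy ~ N^{2/3}-ish ≫ the N/L² coherence
scale; LSSY2005 Ch. 2 after (2.8), Robinson1976, Basti2022 transfer the ENERGY only; Ginibre1965 /
doi:10.1063/1.1704275 and doi:10.1007/bf01035767
transfer reduced density matrices only in the non-condensed low-activity regime), so the transfer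
must be structural: positivity of both ground
states makes the one-particle density matrix a Bhattacharyya affinity of Palm measures
(point-process calculus: Campbell–Mecke / GNZ, LastPenrose2017,
Kallenberg2021), and in the Papangelou normalisation the extensive, environment-only part of the
wall weight |Ψ_D|²/|Ψ_P|² cancels identically,
leaving the wall×tag CONNECTED influence, an infrared-convergent quantity in d = 3 (∫_{k<1/d}|û|²S ~
(ξ/d)² with û ~ 1/|k|, S ~ |k|; ReattoChester1967)
— the imported area is Palm/Papangelou calculus plus Dobrushin-type influence bounds (Dobrushin1968,
Georgii1994) for two distant tilts of one spatially
mixing measure, pointed at the ground-state measure. What it does that other routes do not: the five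
open routes wanting BoundaryTransferWeak
(stmt-0827: BECIroning, BECLaplacianL1, BECGroundStateSOS, BECStronglyRayleigh, BECMeanFieldControl)
file it with no mechanism; here its content is
DECOMPOSED (the items prove stmt-0827 per potential as a by-product, theorem `transfer` in
Sketch.lean, rc 0), the Dirichlet conclusion is mode-free
(the state's own density mode, immune to the free-gas (8/π²)³ constant-mode artefact), and both new
cruxes are exact (error 0) at v = 0.

RANKED CRUXES. #2 TiltCommutation (crux) — (card TRANSFER LEMMA, integrated form) for every
repulsive finite-range v there is ρ₀ > 0 such that for 0 < ρ < ρ₀ and every η > 0, for all large N =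
n+1 (L = (N/ρ)^{1/3}), for every Dirichlet ground state Φ (measurable, supported in the box,
normalised, E₀(N,L) < ∞, L²-limit of a minimising sequence of TrialStates) and every periodic ground
state Θ of the torus of the same side (same data with PeriodicTrialState on the cell): with ρ_Φ(x) =
N∫|Φ(x,Y)|²dY, m_Φ(Y) = ∫|Φ(z,Y)|²dz, λ(x;Y) = |Θ(x,Y)|²1_cell/∫|Θ(z,Y)|²1_cell dz (periodic
insertion = Papangelou weight) and π_x(Y) = λ(x;Y)m_Φ(Y)/∫λ(x;W)m_Φ(W)dW, one has ∫dx∫dY |N|Φ(x,Y)|²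
− ρ_Φ(x)π_x(Y)| ≤ ηN: the Palm law of |Φ|² at x IS the periodic-insertion tilt of the wall-tilted
marginal in density-weighted mean TV (wall tilt and tag tilt commute); exact at v = 0. [difficulty:
XL] (why it might fail: Needs the wall×tag CONNECTED influence to be o(1) per particle in L¹ at
fixed ρ as L→∞ (heuristic (ξ/d)²√(ρa³), IR-finite only because S(k)~k, û~1/k in d=3); a
non-vanishing O(√(ρa³)) cross term, or degenerate (hard-core) ground states, break the ∀η>0 form.)
[LastPenrose2017, Kallenberg2021, Dobrushin1968, ReattoChester1967, LSSY2005, Robinson1976,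
KonigVogelZass2025, Ginibre1965]
#3 BulkIndistinguishability (crux) — (card BULK INDISTINGUISHABILITY, affinity form) same data and
the same ρ_Φ, m_Φ, λ, π as in TiltCommutation, plus the torus Palm affinity b_Θ(x,y) =
L³∫|Θ(x,Y)||Θ(y,Y)|1_cell dY: ∫∫ρ_Φ(x)ρ_Φ(y)·[b_Θ(x,y) − BC(π_x,π_y)]₊ dx dy ≤ ηN² with BC(π_x,π_y)
= ∫√(π_x(Y)π_y(Y))dY — two bulk insertions see the same environment statistics under the wall-tilted
(N−1)-marginal m_Φ as under the torus marginal: (i) equality of the one-point insertion statistic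
(E√λ_x)²/Eλ_x in the bulk of the box and on the torus, (ii) decorrelation of distant insertions
under m_Φ; one-sided, pairs near the walls discounted by ρ_Φ⊗ρ_Φ (layer mass fraction ~6ξ/L → 0);
exact at v = 0 (b_Θ ≡ 1 ≡ BC). [deps: TiltCommutation] [difficulty: XL] (why it might fail: It is
BC-independence of bulk LOCAL statistics of |Ψ₀|² plus mixing of the wall-tilted measure — an
infinite-volume uniqueness statement for the ground-state point process, nothing in print for v≠0
(Dobrushin bounds need a quasilocal specification); phonon tails make λ only quasi-local.)
[Dobrushin1968, Georgii1994, VandenbergLewisPule1986, PuleZagrebnov2004, BoccatoSeiringer2023,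
Junge2026, LSSY2005, LastPenrose2017]
#4 PeriodicBEC (crux) — (shared verbatim with stmt-AtomisticToContinuum-0826; the only off-diagonal
input, consumed as a black box) for every repulsive finite-range radial v there is ρ₀>0 such that
for 0<ρ<ρ₀ there is c>0 with: for all large N there is δ>0 such that every PERIODIC trial state Ψ on
the torus of side L=(N/ρ)^{1/3} with periodicEnergy ≤ E₀^per(N,L)+δ has condensateOccupation N L Ψ ≥
cN. This route adds nothing to its proof (torus-method routes BECIroning / BECPhononFloor /
BECStoquasticCensoring … supply it). [difficulty: open-problem] (why it might fail: Box
L=(N/ρ)^{1/3}→∞ at fixed ρ: every printed bound on n₊ pays the inverse kinetic gap L², so it is o(N)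
only up to L≲a(ρa³)^{-3/4-η} (Fournais2020 Thm 1.2; Junge2026 Cor 6); T=0 Bogoliubov expansions
diverge in d=3; hard cores admissible, c uniform in N.) [LSSY2005, Fournais2020, arXiv:2011.00309,
Junge2026, arXiv:2603.20776, ChongLiangNam2026, arXiv:2510.20493,
Literature.Barriers.AtomisticToContinuum.KineticGapLengthScales]
#9 PairAlgebra (support) — (affinity algebra, per instance, no ground-state hypotheses; shared
verbatim with stmt-AtomisticToContinuum-5121) for any n, L, η ≥ 0, c and measurable Φ, Θ :
Config(n+1) → ℂ with Φ supported in the box and ∫|Φ|² = 1: the TiltCommutation inequality (error η),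
the BulkIndistinguishability inequality (error η) and the weighted torus coherence c·N·(∫_cell ρ_Φ)²
≤ N∫∫ρ_Φ(x)ρ_Φ(y)b_Θ(x,y) imply Q(Φ) := ∫dY(∫√ρ_Φ(x)·|Φ(x,Y)|dx)² ≥ (c − 4η − 4√η)·N. Proof (true
constant η+2√η): NQ = ∫∫√(ρ_Φ(x)ρ_Φ(y))∫√(a_x a_y)dY with a_x(Y) = N|Φ(x,Y)|²; Hellinger step
|∫√(a_x a_y) − ∫√(b_x b_y)| ≤ √(‖a_x−b_x‖₁·∫a_y) + √(∫b_x·‖a_y−b_y‖₁) with b_x = ρ_Φ(x)π_x (∫π_x ≤ 1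
in every ENNReal corner case), ∫√(b_x b_y) = √(ρ_Φ(x)ρ_Φ(y))·BC(π_x,π_y); Cauchy–Schwarz against ρ_Φ
(mass N) turns the C1 error ηN into 2√η·N²; C2 gives ∫∫ρρBC ≥ ∫∫ρρ b − ηN²; coherence gives ∫∫ρρ b ≥
cN² (c ≤ 1+η is forced, so n = 0 and c ≤ 0 corners are harmless). [difficulty: provable-now]
[PenroseOnsager1956, LSSY2005, LastPenrose2017]
#9 TorusAveraging (support) — (per potential) for every repulsive finite-range v: [PeriodicBEC body
for v] → there is ρ₀ such that for ρ<ρ₀ there is c>0 with, for all large N = n+1 and every Dirichlet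
ground state Φ, SOME periodic ground state Θ (the periodised, translated L²(cell^N)-limit of a
periodic minimising sequence) satisfying c·N·(∫_cell ρ_Φ)² ≤ N∫∫ρ_Φ(x)ρ_Φ(y)b_Θ(x,y). Proof: E₀^per
< ∞ for ρR₀³ small (grid of symmetrised bumps); bounded kinetic energy + Rellich on the torus give
L²(cell^N)-limits Θ₀ of minimising sequences with condensateOccupation(Θ₀) ≥ cN (L²-continuity);
periodise Θ₀ off the cell, translate by t (again such a limit); for f = ρ_Φ ≥ 0: N∫∫f f b_{Θ_t} ≥
L³N∫dY|∫f(x)Θ₀(x+t,Y)dx|², whose t-average is ≥ (∫f)²·n₀(Θ₀)/1 by Jensen in t and periodicity; pick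
t above the average. [difficulty: L] [Fournais2020, ReedSimonIV1978, LSSY2005]
#9 GroundStateReduction (support) — (per potential) for every repulsive finite-range v: if there are
ρ₀ and, for ρ<ρ₀, some c>0 such that for all large N = n+1 every Dirichlet ground state Φ (as in
TiltCommutation) has Q(Φ) = ∫dY(∫√ρ_Φ(x)|Φ(x,Y)|dx)² ≥ cN, then ∃ρ₀'>0 ∀ρ∈(0,ρ₀') HasGroundStateBEC
v ρ. Proof: shrink ρ₀ so that E₀(N,L) < ∞ eventually (bumps); if condensateNumber < (c/2)N for some
large N, then for every δ>0 some δ-near-minimiser has maxOccupation < (c/2)N; a minimising sequence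
of such states converges in L² (Rellich, H¹₀ of the box) to a ground state Φ; uniqueness/positivity
of the Dirichlet ground state (Perron–Frobenius / Beurling–Deny for −Δ+V on the connected admissible
region, Reed–Simon XIII.47; hard cores: connectedness of the hard-sphere configuration space at low
density) makes Φ(·,Y) of constant phase, so the occupation of the FIXED normalised mode u = √(ρ_Φ/N)
in Ψ_k tends to N∫|∫ūΦ|² = Q(Φ) ≥ cN — contradiction; finish with occupation_le_maxOccupation and
le_condensateNumber. All near-minimiser/compactness/phase plumbing of the variational conjunct is
paid here, once. [difficulty: L] [ReedSimonIV1978, LSSY2005, LiebSeiringer2002]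

TWO-LAYER PLAN. Foreseen glued splits (k ≤ 3, depth 1; nothing filed now): TiltCommutation ⇐
EnvelopeFactorisation (λ_D(x;·) = a(x)λ_P(x;·)(1+r) on the
m_Φ-typical set, one bulk point) → CrossInfluenceDecay (E|r| ≤ η(dist(x,∂Λ)) with η(d) → 0, the
Dobrushin/Feynman–Kac influence estimate) →
TiltCommutation; BulkIndistinguishability ⇐ OnePointIndistinguishability ((E√λ_x)²/Eλ_x under m_Φ vs
m_Θ, bulk x) → InsertionDecorrelation
(mixing of distant insertions under m_Φ) → BulkIndistinguishability; GroundStateReduction ⇐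
NearMinimiserCompactness → PhaseRigidity →
GroundStateReduction. A Jastrow-anchor special case of C1/C2 (Φ, Θ replaced by Dirichlet/periodic
Jastrow products = classical low-activity Gibbs
measures differing by a boundary field — Dobrushin-uniqueness territory) is the natural first child
if a prover wants a provable-now rung.

KILL CRITERIA. ¬TiltCommutation or ¬BulkIndistinguishability for some admissible v at arbitrarily
small ρ (e.g. a proof that the wall×tag connected influence per
particle stays ≥ c√(ρa³) as L → ∞, or that Dirichlet bulk Palm affinities fall below the torus ones
by a fixed amount) closes the route
(`close --reason refuted:<Decl>`) but not the conjunct. ¬PeriodicBEC kills this route and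
(physically) the conjunct. A refutation that only breaks
the ∀η>0 form (error small but not vanishing) forces a pivot: re-file C1/C2 with error ≤ κ(ρ)N, κ(ρ)
→ 0 as ρ → 0, and consume a quantitative
PeriodicBEC (c(ρ) → 1). BoundaryTransferWeak (stmt-0827) proved by another mechanism (Neumann
bracketing + λ_max ≥ tr γ²/N) ⇒ close superseded
(this route then reduces to BECPeriodicReduction). A refutation of a support item in an ENNReal
corner (cf. negatives index stmt-3980) ⇒ repair by
`workitem add … R` with the guard, glue re-certified.

NOT DECOMPOSED YET. The influence technology itself (Dobrushin/Künsch bounds presuppose a quasilocal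
specification that |Ψ₀|² lacks; the intended arena is the
ground-state Feynman–Kac path measure where walls = killing and the tag = an inserted world-line are
genuine local factors); existence /
uniqueness / H¹-compactness of ground states in the C¹ variational formalisation and connectedness
of the hard-sphere configuration space at low
density (inside the support items, paid once); the rate η(d); the Jastrow and mean-field anchors; T
> 0; Casimir (anisotropic) boxes; any attempt
on PeriodicBEC (other routes).

CHEAPEST FALSIFIER. v = 0, by hand (repeated this session): Φ = ∏ᵢ φ₁(xᵢ) (Dirichlet sine product),
Θ = L^{−3N/2} on the cell; then λ ≡ L⁻³1_cell, π_x = m_Φ exactly,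
so the C1 integrand vanishes identically; b_Θ ≡ 1 ≡ BC(π_x,π_y), so C2's integrand vanishes;
TorusAveraging holds with c = 1 and Q(Φ) = N — the line
PASSES where constant-mode routes see the (8/π²)³ artefact; PairAlgebra's corners n = 0, c ≤ 0, L ≤
0, unnormalised Θ checked by hand (C2 + BC ≤ 1
force c ≤ 1 + η). Next cheapest (refuter, kit-sized): the Jastrow anchor — Φ, Θ ↦ ∏φ_GP(xᵢ)∏f(xᵢ−xⱼ)
(box) and ∏f (torus); C1's error is then the
mass within range R₀ of the walls (→ 0) and C2 becomes equality of the bulk one-point insertion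
statistic (E√λ)²/Eλ of two classical low-activity
Gibbs measures differing by a boundary field; a Monte-Carlo estimate of that statistic under both
measures (N ~ 10³, growing L at fixed ρa³) that
drifts apart would retire the card.

NUMBERS. Free gas: Dirichlet constant-mode fraction (8/π²)³ ≈ 0.533 (refuter notes on
stmt-0689/0733) — the reason the conclusion uses the state's own
density mode √(ρ_Φ/N), for which v = 0 gives fraction 1. Healing length ξ = (8πρa)^{−1/2};
boundary-layer mass fraction ≈ 6ξ/L =
6(8πρa)^{−1/2}(ρ/N)^{1/3} → 0 at fixed ρ; heuristic cross influence at distance d: (ξ/d)²√(ρa³),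
density-averaged ∫(ξ/d)²dx/L³ ~ ξ/L → 0.
Printed BEC length scales to beat: L ≲ (ρa)^{−1/2}(ρa³)^{−δ} (Fournais2020 Thm 1.2), R ~
a(ρa³)^{−3/4−η} (Junge2026 Cor. 6) versus L = (N/ρ)^{1/3}.
Glue constants: c' = min c 1, η = (c'/16)², final constant c'/2. Items at open: 7.

DEFINITION REQUESTS. None required: Palm laws, Papangelou weights, tilted laws and affinities are
inlined as lintegrals over `Matrix.vecCons x Y` (N = n+1), and
"ground state" is the inline predicate (measurable, supported/normalised, E₀ ≠ ⊤, L²-limit of a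
minimising sequence). Recommended once a second
route needs them: Literature defs `IsDirichletGroundState`, `IsPeriodicGroundState`, `palmDensity`,
`papangelouWeight` under
Literature/MathematicalPhysics/QuantumManyBody (would shrink every signature here by ~70%).

Novelty: Searches (2026-08-15, this session): `lit frontier AtomisticToContinuum --since 2023` (30 rows; BEC
descendants arXiv:2510.20493, arXiv:2603.20776,
arXiv:2602.16566 — none on boundary-condition transfer of the condensate); `lit search --source
zbmath "Bose-Einstein condensation boundary conditions
interacting"` (12: relevant only KonigVogelZass2025 = arXiv:2312.07481, free gas; Verbeure 2004
zbl:1194.82032, conventional BEC); `lit search --source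
zbmath` long form (0); `lit search --source crossref "reduced density matrices quantum gases
boundary conditions independence thermodynamic limit"` (10:
doi:10.1063/1.1704275 / 10.1063/1.1704276 / 10.1063/1.1704795 Ginibre 1965 I–III,
doi:10.1007/bf01661148 Angelescu–Nenciu 1973, doi:10.1007/bf01035767
Matviichuk 1972, doi:10.1007/s00220-005-1449-8 Hasler–Solovej 2005 — all low-activity /
thermodynamic-function level); `lit search --source arxiv "Palm
measure point process Bose gas ground state ODLRO"` (0); `lit galaxy search --star all "condensate
boundary conditions interacting Bose gas"` (0);
`lit galaxy search --star pdf --mode bm25` (12 physics hits, none structural); `lit search --hybrid`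
unavailable (searchd rc 75) this session; plus the
card's and the three novelty audits' searches recorded on the card (Robinson1976, Landau–Wilde 1979,
VandenbergLewisPule1986: BC dependence of BEC for
the FREE gas; LauwersVerbeureZagrebnov2003 attractive walls; LSSY2005 Ch. 2 after (2.8), Basti2022 =
arXiv:2203.01841: BC transfer of the ENERG  [refs: 10.1063/1.1704275, 10.1063/1.1704276, 10.1063/1.1704795, 10.1007/bf01661148, 10.1007/bf01035767, 10.1007/s00220-005-1449-8, 2510.20493, 2603.20776, 2602.16566, 2312.07481, 2203.01841, doi:10.1063/1.1704275, doi:10.1007/bf01661148, doi:10.1007/bf01035767, doi:10.1007/s00220-005-1449-8, doi:10.1063/1.1704276, KonigVogelZass2025, Robinson1976, VandenbergLewisPule1986, LauwersVerbeureZagrebnov2003, LS]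

Barriers (technique_class: boundary-condition-transfer, palm-affinity, influence-bounds): - technique_class: boundary-condition-transfer, palm-affinity, influence-bounds
- Literature.Barriers.AtomisticToContinuum.KineticGapLengthScales: evaded by the transfer cruxes —
no energy window, no gap, no localisation into sub-boxes; the items speak about ground states (exact
minimising-sequence limits) and a λ_max-type target, which KineticGapLengthScalesNarrow lists as NOT
bound; it APPLIES squarely to the shared crux PeriodicBEC, filed as a black box (the bet: a gap-free
torus mechanism lands first).
- Literature.Barriers.AtomisticToContinuum.EnergyAsymptoticsWithoutCondensation: evaded — no energy
asymptotics enter; energies appear only through E₀ < ∞ and minimising sequences defining the ground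
state.
- Literature.Barriers.AtomisticToContinuum.CasimirBoxGeneralizedCondensation: the relevant warning
(type of condensation depends on geometry/boundary); evaded because the statement is for cubes L =
(N/ρ)^{1/3} with a mode-free conclusion (occupation of √(ρ_Φ/N)), and C1/C2 carry explicit o(N)
errors that would not vanish for Casimir-anisotropic boxes — nothing is claimed there.
- Literature.Barriers.AtomisticToContinuum.SymmetryBreakingWithoutCondensate: not in scope —
canonical, first-quantised, no source field or quasi-average.
- Literature.Barriers.AtomisticToContinuum.BogoliubovPerturbationInfrared: evaded — no perturbative
expansion; the only infrared input is the heuristic SIZE of the cross influence ((ξ/d)², convergent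
in d = 3), never a Bogoliubov series.
- Liter

Novelty grade: new-combination — ROUTE REVIEW (refuter-rreview-0815T18-21-0, 08-15): SOUND, keep open, staffable (cone 35/0). = BECTiltCommutation (retired 13:41Z for FORM only, never reviewed) with TorusAveraging/GroundStateReduction per-potential + genuine `closes`; C1/C2/PeriodicBEC/PairAlgebra verbatim. Novelty: Palm/Papangelou (refuter refuter-rreview-0815T18-21-0, 2026-08-15T19:47:01Z; prior: LastPenrose2017, Kallenberg2021, Dobrushin1968, ReattoChester1967, LSSY2005, Robinson1976, KonigVogelZass2025 (arXiv:2312.07481), Ginibre1965 (doi:10.1063/1.1704275), route-AtomisticToContinuum-BECTiltCommutation (retired, same card), stmt-AtomisticToContinuum-0826/8997 (PeriodicBEC))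

History (route lifecycle, newest last):
- 2026-08-24T09:51:47Z · DORMANT — reconciler: no traction for 6.7 d (last activity item-evidence-added at 2026-08-17T16:56:50Z); parked, not closed — `ledger route dormant route-AtomisticToConti (operator:999:743686)
- 2026-08-29T07:57:06Z · REACTIVATED — reconciler: reactivated — activity statement-checked at 2026-08-29T06:49:25Z after parking at 2026-08-24T09:51:47Z (operator:999:1778274)
- 2026-08-29T19:27:21Z · DORMANT — census g0: costume|duplicate of —; reader census-reader-34-g0 (operator:999:904267)

sub-problem: BoseEinsteinCondensation · status: dormant · opened planner-plancard-AtomisticToContinuum-BoseEin-03930835-g2-0 2026-08-15T18:50:50Z · rev 2 · ledger route-AtomisticToContinuum-BECDistantTilts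
GENERATED by the gate from the ledger (D-0016/17). Provers cite these decls: `theorem foo : Summit.AtomisticToContinuum.BoseEinsteinCondensation.Theses.BECDistantTilts.<Decl> := …` in Summits/AtomisticToContinuum/BoseEinsteinCondensation/Theorems/<Name>.lean.
-/

namespace Summit.AtomisticToContinuum.BoseEinsteinCondensation.Theses.BECDistantTilts

open scoped BigOperators Topology Manifold Classical MeasureTheory ProbabilityTheory Matrix InnerProductSpace ComplexConjugate ContinuousMap
open Filter Set Function TopologicalSpace MeasureTheory

attribute [summit_statement] _root_.BoseEinsteinCondensation

/-- item stmt-AtomisticToContinuum-12177 · crux · rank 2 · open · by planner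
why it might fail: Needs the wall×tag CONNECTED influence to be o(1) per particle in L¹ at fixed ρ as L→∞ (heuristic (ξ/d)²√(ρa³), IR-finite only because S(k)~k, û~1/k in d=3); a non-vanishing O(√(ρa³)) cross term, or degenerate (hard-core) ground states, break the ∀η>0 form.
sources: LastPenrose2017, Kallenberg2021, Dobrushin1968, ReattoChester1967, LSSY2005, Robinson1976
[crux] (card TRANSFER LEMMA, integrated form) for every repulsive finite-range v there is ρ₀ > 0
such that for 0 < ρ < ρ₀ and every η > 0, for all large N = n+1 (L = (N/ρ)^{1/3}), for every
Dirichlet ground state Φ (measurable, supported in the box, normalised, E₀(N,L) < ∞, L²-limit of a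
minimising sequence of TrialStates) and every periodic ground state Θ of the torus of the same side
(same data with PeriodicTrialState on the cell): with ρ_Φ(x) = N∫|Φ(x,Y)|²dY, m_Φ(Y) = ∫|Φ(z,Y)|²dz,
λ(x;Y) = |Θ(x,Y)|²1_cell/∫|Θ(z,Y)|²1_cell dz (periodic insertion = Papangelou weight) and π_x(Y) =
λ(x;Y)m_Φ(Y)/∫λ(x;W)m_Φ(W)dW, one has ∫dx∫dY |N|Φ(x,Y)|² − ρ_Φ(x)π_x(Y)| ≤ ηN: the Palm law of |Φ|²
at x IS the periodic-insertion tilt of the wall-tilted marginal in density-weighted mean TV (wall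
tilt and tag tilt commute); exact at v = 0. [difficulty: XL] -/
@[route_item "route-AtomisticToContinuum-BECDistantTilts", crux]
def TiltCommutation : Prop :=
  ∀ v : ℝ → ENNReal, Literature.MathematicalPhysics.QuantumManyBody.BoseGas.IsRepulsiveFiniteRange v → ∃ ρ₀ : ℝ, 0 < ρ₀ ∧ ∀ ρ : ℝ, 0 < ρ → ρ < ρ₀ → ∀ η : ℝ, 0 < η → ∀ᶠ n : ℕ in Filter.atTop, ∀ L : ℝ, L = Literature.MathematicalPhysics.QuantumManyBody.BoseGas.sideLength ρ (n + 1) → ∀ Φ : Literature.MathematicalPhysics.QuantumManyBody.BoseGas.Config (n + 1) → ℂ, (Measurable Φ ∧ (∀ X, X ∉ Literature.MathematicalPhysics.QuantumManyBody.BoseGas.boxN (n + 1) L → Φ X = 0) ∧ (∫⁻ X, (‖Φ X‖₊ : ENNReal) ^ 2) = 1 ∧ Literature.MathematicalPhysics.QuantumManyBody.BoseGas.groundStateEnergy v (n + 1) L ≠ ⊤ ∧ ∃ Ψ : ℕ → Literature.MathematicalPhysics.QuantumManyBody.BoseGas.TrialState (n + 1) L, Filter.Tendsto (fun k => Literature.MathematicalPhysics.QuantumManyBody.BoseGas.energy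 v (Ψ k)) Filter.atTop (nhds (Literature.MathematicalPhysics.QuantumManyBody.BoseGas.groundStateEnergy v (n + 1) L)) ∧ Filter.Tendsto (fun k => ∫⁻ X, (‖(Ψ k).ψ X - Φ X‖₊ : ENNReal) ^ 2) Filter.atTop (nhds 0)) → ∀ Θ : Literature.MathematicalPhysics.QuantumManyBody.BoseGas.Config (n + 1) → ℂ, (Measurable Θ ∧ (∫⁻ X in Literature.MathematicalPhysics.QuantumManyBody.BoseGas.cellN (n + 1) L, (‖Θ X‖₊ : ENNReal) ^ 2) = 1 ∧ Literature.MathematicalPhysics.QuantumManyBody.BoseGas.periodicGroundStateEnergy v (n + 1) L ≠ ⊤ ∧ ∃ Ψ : ℕ → Literature.MathematicalPhysics.QuantumManyBody.BoseGas.PeriodicTrialState (n + 1) L, Filter.Tendsto (fun k => Literature.MathematicalPhysics.QuantumManyBody.BoseGas.periodicEnergy v (Ψ k)) Filter.atTop (nhds (Literature.MathematicalPhysics.QuantumManyBody.BoseGas.periodicGroundStateEnergy v (n + 1) L)) ∧ Filter.Tendsto (fun k => ∫⁻ X in Literature.MathematicalPhysics.QuantumManyBody.BoseGas.cellN (n +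 1) L, (‖(Ψ k).ψ X - Θ X‖₊ : ENNReal) ^ 2) Filter.atTop (nhds 0)) → ∀ ρΦ : Literature.MathematicalPhysics.QuantumManyBody.BoseGas.Space → ENNReal, ρΦ = (fun x => ((n : ENNReal) + 1) * ∫⁻ Y : Literature.MathematicalPhysics.QuantumManyBody.BoseGas.Config n, (‖Φ (Matrix.vecCons x Y)‖₊ : ENNReal) ^ 2) → ∀ mΦ : Literature.MathematicalPhysics.QuantumManyBody.BoseGas.Config n → ENNReal, mΦ = (fun Y => ∫⁻ z : Literature.MathematicalPhysics.QuantumManyBody.BoseGas.Space, (‖Φ (Matrix.vecCons z Y)‖₊ : ENNReal) ^ 2) → ∀ lam : Literature.MathematicalPhysics.QuantumManyBody.BoseGas.Space → Literature.MathematicalPhysics.QuantumManyBody.BoseGas.Config n → ENNReal, lam = (fun x Y => ((Literature.MathematicalPhysics.QuantumManyBody.BoseGas.cellN (n + 1) L).indicator (fun X => (‖Θ X‖₊ : ENNReal) ^ 2) (Matrix.vecCons x Y)) / ∫⁻ z : Literature.MathematicalPhysics.QuantumManyBody.BoseGas.Space, ((Literature.MathematicalPhysics.QuantumManyBody.BoseGas.cellN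 (n + 1) L).indicator (fun X => (‖Θ X‖₊ : ENNReal) ^ 2) (Matrix.vecCons z Y))) → ∀ π : Literature.MathematicalPhysics.QuantumManyBody.BoseGas.Space → Literature.MathematicalPhysics.QuantumManyBody.BoseGas.Config n → ENNReal, π = (fun x Y => lam x Y * mΦ Y / ∫⁻ W : Literature.MathematicalPhysics.QuantumManyBody.BoseGas.Config n, lam x W * mΦ W) → ∫⁻ x : Literature.MathematicalPhysics.QuantumManyBody.BoseGas.Space, ∫⁻ Y : Literature.MathematicalPhysics.QuantumManyBody.BoseGas.Config n, ((((n : ENNReal) + 1) * (‖Φ (Matrix.vecCons x Y)‖₊ : ENNReal) ^ 2 - ρΦ x * π x Y) + (ρΦ x * π x Y - ((n : ENNReal) + 1) * (‖Φ (Matrix.vecCons x Y)‖₊ : ENNReal) ^ 2)) ≤ ENNReal.ofReal η * ((n : ENNReal) + 1)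

/-- item stmt-AtomisticToContinuum-12178 · crux · rank 3 · open · by planner
why it might fail: It is BC-independence of bulk LOCAL statistics of |Ψ₀|² plus mixing of the wall-tilted measure — an infinite-volume uniqueness statement for the ground-state point process, nothing in print for v≠0 (Dobrushin bounds need a quasilocal specification); phonon tails make λ only quasi-local.
sources: Dobrushin1968, Georgii1994, VandenbergLewisPule1986, PuleZagrebnov2004, BoccatoSeiringer2023, Junge2026
[crux] (card BULK INDISTINGUISHABILITY, affinity form) same data and the same ρ_Φ, m_Φ, λ, π as in
TiltCommutation, plus the torus Palm affinity b_Θ(x,y) = L³∫|Θ(x,Y)||Θ(y,Y)|1_cell dY: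
∫∫ρ_Φ(x)ρ_Φ(y)·[b_Θ(x,y) − BC(π_x,π_y)]₊ dx dy ≤ ηN² with BC(π_x,π_y) = ∫√(π_x(Y)π_y(Y))dY — two
bulk insertions see the same environment statistics under the wall-tilted (N−1)-marginal m_Φ as
under the torus marginal: (i) equality of the one-point insertion statistic (E√λ_x)²/Eλ_x in the
bulk of the box and on the torus, (ii) decorrelation of distant insertions under m_Φ; one-sided,
pairs near the walls discounted by ρ_Φ⊗ρ_Φ (layer mass fraction ~6ξ/L → 0); exact at v = 0 (b_Θ ≡ 1
≡ BC). [deps: TiltCommutation] [difficulty: XL] -/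
@[route_item "route-AtomisticToContinuum-BECDistantTilts", crux]
def BulkIndistinguishability : Prop :=
  ∀ v : ℝ → ENNReal, Literature.MathematicalPhysics.QuantumManyBody.BoseGas.IsRepulsiveFiniteRange v → ∃ ρ₀ : ℝ, 0 < ρ₀ ∧ ∀ ρ : ℝ, 0 < ρ → ρ < ρ₀ → ∀ η : ℝ, 0 < η → ∀ᶠ n : ℕ in Filter.atTop, ∀ L : ℝ, L = Literature.MathematicalPhysics.QuantumManyBody.BoseGas.sideLength ρ (n + 1) → ∀ Φ : Literature.MathematicalPhysics.QuantumManyBody.BoseGas.Config (n + 1) → ℂ, (Measurable Φ ∧ (∀ X, X ∉ Literature.MathematicalPhysics.QuantumManyBody.BoseGas.boxN (n + 1) L → Φ X = 0) ∧ (∫⁻ X, (‖Φ X‖₊ : ENNReal) ^ 2) = 1 ∧ Literature.MathematicalPhysics.QuantumManyBody.BoseGas.groundStateEnergy v (n + 1) L ≠ ⊤ ∧ ∃ Ψ : ℕ → Literature.MathematicalPhysics.QuantumManyBody.BoseGas.TrialState (n + 1) L, Filter.Tendsto (fun k => Literature.MathematicalPhysics.QuantumManyBody.BoseGas.energy v (Ψ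 k)) Filter.atTop (nhds (Literature.MathematicalPhysics.QuantumManyBody.BoseGas.groundStateEnergy v (n + 1) L)) ∧ Filter.Tendsto (fun k => ∫⁻ X, (‖(Ψ k).ψ X - Φ X‖₊ : ENNReal) ^ 2) Filter.atTop (nhds 0)) → ∀ Θ : Literature.MathematicalPhysics.QuantumManyBody.BoseGas.Config (n + 1) → ℂ, (Measurable Θ ∧ (∫⁻ X in Literature.MathematicalPhysics.QuantumManyBody.BoseGas.cellN (n + 1) L, (‖Θ X‖₊ : ENNReal) ^ 2) = 1 ∧ Literature.MathematicalPhysics.QuantumManyBody.BoseGas.periodicGroundStateEnergy v (n + 1) L ≠ ⊤ ∧ ∃ Ψ : ℕ → Literature.MathematicalPhysics.QuantumManyBody.BoseGas.PeriodicTrialState (n + 1) L, Filter.Tendsto (fun k => Literature.MathematicalPhysics.QuantumManyBody.BoseGas.periodicEnergy v (Ψ k)) Filter.atTop (nhds (Literature.MathematicalPhysics.QuantumManyBody.BoseGas.periodicGroundStateEnergy v (n + 1) L)) ∧ Filter.Tendsto (fun k => ∫⁻ X in Literature.MathematicalPhysics.QuantumManyBody.BoseGas.cellN (n + 1) L, (‖(Ψ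 k).ψ X - Θ X‖₊ : ENNReal) ^ 2) Filter.atTop (nhds 0)) → ∀ ρΦ : Literature.MathematicalPhysics.QuantumManyBody.BoseGas.Space → ENNReal, ρΦ = (fun x => ((n : ENNReal) + 1) * ∫⁻ Y : Literature.MathematicalPhysics.QuantumManyBody.BoseGas.Config n, (‖Φ (Matrix.vecCons x Y)‖₊ : ENNReal) ^ 2) → ∀ mΦ : Literature.MathematicalPhysics.QuantumManyBody.BoseGas.Config n → ENNReal, mΦ = (fun Y => ∫⁻ z : Literature.MathematicalPhysics.QuantumManyBody.BoseGas.Space, (‖Φ (Matrix.vecCons z Y)‖₊ : ENNReal) ^ 2) → ∀ lam : Literature.MathematicalPhysics.QuantumManyBody.BoseGas.Space → Literature.MathematicalPhysics.QuantumManyBody.BoseGas.Config n → ENNReal, lam = (fun x Y => ((Literature.MathematicalPhysics.QuantumManyBody.BoseGas.cellN (n + 1) L).indicator (fun X => (‖Θ X‖₊ : ENNReal) ^ 2) (Matrix.vecCons x Y)) / ∫⁻ z : Literature.MathematicalPhysics.QuantumManyBody.BoseGas.Space, ((Literature.MathematicalPhysics.QuantumManyBody.BoseGas.cellN (n + 1)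 L).indicator (fun X => (‖Θ X‖₊ : ENNReal) ^ 2) (Matrix.vecCons z Y))) → ∀ π : Literature.MathematicalPhysics.QuantumManyBody.BoseGas.Space → Literature.MathematicalPhysics.QuantumManyBody.BoseGas.Config n → ENNReal, π = (fun x Y => lam x Y * mΦ Y / ∫⁻ W : Literature.MathematicalPhysics.QuantumManyBody.BoseGas.Config n, lam x W * mΦ W) → ∀ b : Literature.MathematicalPhysics.QuantumManyBody.BoseGas.Space → Literature.MathematicalPhysics.QuantumManyBody.BoseGas.Space → ENNReal, b = (fun x y => ENNReal.ofReal (L ^ 3) * ∫⁻ Y : Literature.MathematicalPhysics.QuantumManyBody.BoseGas.Config n, (((Literature.MathematicalPhysics.QuantumManyBody.BoseGas.cellN (n + 1) L).indicator (fun X => (‖Θ X‖₊ : ENNReal) ^ 2) (Matrix.vecCons x Y)) * ((Literature.MathematicalPhysics.QuantumManyBody.BoseGas.cellN (n + 1) L).indicator (fun X => (‖Θ X‖₊ : ENNReal) ^ 2) (Matrix.vecCons y Y))) ^ ((1 : ℝ) / 2)) → ∫⁻ x : Literature.MathematicalPhysics.QuantumManyBody.BoseGas.Space, ∫⁻ y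 : Literature.MathematicalPhysics.QuantumManyBody.BoseGas.Space, ρΦ x * ρΦ y * (b x y - ∫⁻ Y : Literature.MathematicalPhysics.QuantumManyBody.BoseGas.Config n, (π x Y * π y Y) ^ ((1 : ℝ) / 2)) ≤ ENNReal.ofReal η * ((n : ENNReal) + 1) ^ 2

/-- item stmt-AtomisticToContinuum-8997 · crux · rank 4 · open · by planner
why it might fail: Box L=(N/ρ)^{1/3}→∞ at fixed ρ: every printed bound on n₊ pays the inverse kinetic gap L², so it is o(N) only up to L≲a(ρa³)^{-3/4-η} (Fournais2020 Thm 1.2; Junge2026 Cor 6); T=0 Bogoliubov expansions diverge in d=3; hard cores admissible, c uniform in N.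
sources: LSSY2005, Fournais2020, arXiv:2011.00309, Junge2026, arXiv:2603.20776, ChongLiangNam2026
[target] constant-mode BEC for δ-near-minimisers of the periodic N-body energy on the torus of side
(N/ρ)^{1/3} at all small densities — verbatim the signature of BECPeriodicReduction.PeriodicBEC
(stmt-AtomisticToContinuum-0826); what X buys through ContinuationToPeriodicBEC (or
CoreSubharmonicCoherence through CoreContinuation). -/
@[route_item "route-AtomisticToContinuum-BECDistantTilts", crux]
def PeriodicBEC : Prop :=
  ∀ v : ℝ → ENNReal, Literature.MathematicalPhysics.QuantumManyBody.BoseGas.IsRepulsiveFiniteRange v → ∃ ρ₀ : ℝ, 0 < ρ₀ ∧ ∀ ρ : ℝ, 0 < ρ → ρ < ρ₀ → ∃ c : ℝ, 0 < c ∧ ∀ᶠ N : ℕ in Filter.atTop, ∃ δ : ENNReal, 0 < δ ∧ ∀ Ψ : Literature.MathematicalPhysics.QuantumManyBody.BoseGas.PeriodicTrialState N (Literature.MathematicalPhysics.QuantumManyBody.BoseGas.sideLength ρ N), Literature.MathematicalPhysics.QuantumManyBody.BoseGas.periodicEnergy v Ψ ≤ Literature.MathematicalPhysics.QuantumManyBody.BoseGas.periodicGroundStateEnergy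 v N (Literature.MathematicalPhysics.QuantumManyBody.BoseGas.sideLength ρ N) + δ → ENNReal.ofReal (c * N) ≤ Literature.MathematicalPhysics.QuantumManyBody.BoseGas.condensateOccupation N (Literature.MathematicalPhysics.QuantumManyBody.BoseGas.sideLength ρ N) Ψ.ψ

/-- item stmt-AtomisticToContinuum-12179 · support · rank 9 · open · by planner
sources: PenroseOnsager1956, LSSY2005, LastPenrose2017
[support] (affinity algebra, per instance, no ground-state hypotheses; shared verbatim with
stmt-AtomisticToContinuum-5121) for any n, L, η ≥ 0, c and measurable Φ, Θ : Config(n+1) → ℂ with Φ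
supported in the box and ∫|Φ|² = 1: the TiltCommutation inequality (error η), the
BulkIndistinguishability inequality (error η) and the weighted torus coherence c·N·(∫_cell ρ_Φ)² ≤
N∫∫ρ_Φ(x)ρ_Φ(y)b_Θ(x,y) imply Q(Φ) := ∫dY(∫√ρ_Φ(x)·|Φ(x,Y)|dx)² ≥ (c − 4η − 4√η)·N. Proof (true
constant η+2√η): NQ = ∫∫√(ρ_Φ(x)ρ_Φ(y))∫√(a_x a_y)dY with a_x(Y) = N|Φ(x,Y)|²; Hellinger step
|∫√(a_x a_y) − ∫√(b_x b_y)| ≤ √(‖a_x−b_x‖₁·∫a_y) + √(∫b_x·‖a_y−b_y‖₁) with b_x = ρ_Φ(x)π_x (∫π_x ≤ 1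
in every ENNReal corner case), ∫√(b_x b_y) = √(ρ_Φ(x)ρ_Φ(y))·BC(π_x,π_y); Cauchy–Schwarz against ρ_Φ
(mass N) turns the C1 error ηN into 2√η·N²; C2 gives ∫∫ρρBC ≥ ∫∫ρρ b − ηN²; coherence gives ∫∫ρρ b ≥
cN² (c ≤ 1+η is forced, so n = 0 and c ≤ 0 corners are harmless). [difficulty: provable-now] -/
@[route_item "route-AtomisticToContinuum-BECDistantTilts", crux]
def PairAlgebra : Prop :=
  ∀ (n : ℕ) (L η c : ℝ) (Φ Θ : Literature.MathematicalPhysics.QuantumManyBody.BoseGas.Config (n + 1) → ℂ), 0 ≤ η → Measurable Φ → Measurable Θ → (∀ X, X ∉ Literature.MathematicalPhysics.QuantumManyBody.BoseGas.boxN (n + 1) L → Φ X = 0) → (∫⁻ X, (‖Φ X‖₊ : ENNReal) ^ 2) = 1 → ∀ ρΦ : Literature.MathematicalPhysics.QuantumManyBody.BoseGas.Space → ENNReal, ρΦ = (fun x => ((n : ENNReal) + 1) * ∫⁻ Y : Literature.MathematicalPhysics.QuantumManyBody.BoseGas.Config n, (‖Φ (Matrix.vecCons x Y)‖₊ : ENNReal)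 ^ 2) → ∀ mΦ : Literature.MathematicalPhysics.QuantumManyBody.BoseGas.Config n → ENNReal, mΦ = (fun Y => ∫⁻ z : Literature.MathematicalPhysics.QuantumManyBody.BoseGas.Space, (‖Φ (Matrix.vecCons z Y)‖₊ : ENNReal) ^ 2) → ∀ lam : Literature.MathematicalPhysics.QuantumManyBody.BoseGas.Space → Literature.MathematicalPhysics.QuantumManyBody.BoseGas.Config n → ENNReal, lam = (fun x Y => ((Literature.MathematicalPhysics.QuantumManyBody.BoseGas.cellN (n + 1) L).indicator (fun X => (‖Θ X‖₊ : ENNReal) ^ 2) (Matrix.vecCons x Y)) / ∫⁻ z : Literature.MathematicalPhysics.QuantumManyBody.BoseGas.Space, ((Literature.MathematicalPhysics.QuantumManyBody.BoseGas.cellN (n + 1) L).indicator (fun X => (‖Θ X‖₊ : ENNReal) ^ 2) (Matrix.vecCons z Y))) → ∀ π : Literature.MathematicalPhysics.QuantumManyBody.BoseGas.Space → Literature.MathematicalPhysics.QuantumManyBody.BoseGas.Config n → ENNReal, π = (fun x Y => lam x Y * mΦ Y / ∫⁻ W : Literature.MathematicalPhysics.QuantumManyBody.BoseGas.Config n, lam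 x W * mΦ W) → ∀ b : Literature.MathematicalPhysics.QuantumManyBody.BoseGas.Space → Literature.MathematicalPhysics.QuantumManyBody.BoseGas.Space → ENNReal, b = (fun x y => ENNReal.ofReal (L ^ 3) * ∫⁻ Y : Literature.MathematicalPhysics.QuantumManyBody.BoseGas.Config n, (((Literature.MathematicalPhysics.QuantumManyBody.BoseGas.cellN (n + 1) L).indicator (fun X => (‖Θ X‖₊ : ENNReal) ^ 2) (Matrix.vecCons x Y)) * ((Literature.MathematicalPhysics.QuantumManyBody.BoseGas.cellN (n + 1) L).indicator (fun X => (‖Θ X‖₊ : ENNReal) ^ 2) (Matrix.vecCons y Y))) ^ ((1 : ℝ) / 2)) → ∫⁻ x : Literature.MathematicalPhysics.QuantumManyBody.BoseGas.Space, ∫⁻ Y : Literature.MathematicalPhysics.QuantumManyBody.BoseGas.Config n, ((((n : ENNReal) + 1) * (‖Φ (Matrix.vecCons x Y)‖₊ : ENNReal) ^ 2 - ρΦ x * π x Y) + (ρΦ x * π x Y - ((n : ENNReal) + 1) * (‖Φ (Matrix.vecCons x Y)‖₊ : ENNReal) ^ 2)) ≤ ENNReal.ofReal η * ((n : ENNReal)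 + 1) → ∫⁻ x : Literature.MathematicalPhysics.QuantumManyBody.BoseGas.Space, ∫⁻ y : Literature.MathematicalPhysics.QuantumManyBody.BoseGas.Space, ρΦ x * ρΦ y * (b x y - ∫⁻ Y : Literature.MathematicalPhysics.QuantumManyBody.BoseGas.Config n, (π x Y * π y Y) ^ ((1 : ℝ) / 2)) ≤ ENNReal.ofReal η * ((n : ENNReal) + 1) ^ 2 → ENNReal.ofReal c * ((n : ENNReal) + 1) * (∫⁻ x in Literature.MathematicalPhysics.QuantumManyBody.BoseGas.cell L, ρΦ x) ^ 2 ≤ ((n : ENNReal) + 1) * ∫⁻ x : Literature.MathematicalPhysics.QuantumManyBody.BoseGas.Space, ∫⁻ y : Literature.MathematicalPhysics.QuantumManyBody.BoseGas.Space, ρΦ x * ρΦ y * b x y → ENNReal.ofReal ((c - 4 * η - 4 * Real.sqrt η) * ((n : ℝ) + 1)) ≤ ∫⁻ Y : Literature.MathematicalPhysics.QuantumManyBody.BoseGas.Config n, (∫⁻ x : Literature.MathematicalPhysics.QuantumManyBody.BoseGas.Space, (ρΦ x) ^ ((1 : ℝ) / 2) * (‖Φ (Matrix.vecCons x Y)‖₊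 : ENNReal)) ^ 2

/-- item stmt-AtomisticToContinuum-12180 · support · rank 9 · open · by planner
sources: Fournais2020, ReedSimonIV1978, LSSY2005
[support] (per potential) for every repulsive finite-range v: [PeriodicBEC body for v] → there is ρ₀
such that for ρ<ρ₀ there is c>0 with, for all large N = n+1 and every Dirichlet ground state Φ, SOME
periodic ground state Θ (the periodised, translated L²(cell^N)-limit of a periodic minimising
sequence) satisfying c·N·(∫_cell ρ_Φ)² ≤ N∫∫ρ_Φ(x)ρ_Φ(y)b_Θ(x,y). Proof: E₀^per < ∞ for ρR₀³ small
(grid of symmetrised bumps); bounded kinetic energy + Rellich on the torus give L²(cell^N)-limits Θ₀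
of minimising sequences with condensateOccupation(Θ₀) ≥ cN (L²-continuity); periodise Θ₀ off the
cell, translate by t (again such a limit); for f = ρ_Φ ≥ 0: N∫∫f f b_{Θ_t} ≥
L³N∫dY|∫f(x)Θ₀(x+t,Y)dx|², whose t-average is ≥ (∫f)²·n₀(Θ₀)/1 by Jensen in t and periodicity; pick
t above the average. [difficulty: L] -/
@[route_item "route-AtomisticToContinuum-BECDistantTilts", crux]
def TorusAveraging : Prop :=
  ∀ v : ℝ → ENNReal, Literature.MathematicalPhysics.QuantumManyBody.BoseGas.IsRepulsiveFiniteRange v → (∃ ρ₀ : ℝ, 0 < ρ₀ ∧ ∀ ρ : ℝ, 0 < ρ → ρ < ρ₀ → ∃ c : ℝ, 0 < c ∧ ∀ᶠ N : ℕ in Filter.atTop, ∃ δ : ENNReal, 0 < δ ∧ ∀ Ψ : Literature.MathematicalPhysics.QuantumManyBody.BoseGas.PeriodicTrialState N (Literature.MathematicalPhysics.QuantumManyBody.BoseGas.sideLength ρ N), Literature.MathematicalPhysics.QuantumManyBody.BoseGas.periodicEnergy v Ψ ≤ Literature.MathematicalPhysics.QuantumManyBody.BoseGas.periodicGroundStateEnergy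 v N (Literature.MathematicalPhysics.QuantumManyBody.BoseGas.sideLength ρ N) + δ → ENNReal.ofReal (c * N) ≤ Literature.MathematicalPhysics.QuantumManyBody.BoseGas.condensateOccupation N (Literature.MathematicalPhysics.QuantumManyBody.BoseGas.sideLength ρ N) Ψ.ψ) → ∃ ρ₀ : ℝ, 0 < ρ₀ ∧ ∀ ρ : ℝ, 0 < ρ → ρ < ρ₀ → ∃ c : ℝ, 0 < c ∧ ∀ᶠ n : ℕ in Filter.atTop, ∀ L : ℝ, L = Literature.MathematicalPhysics.QuantumManyBody.BoseGas.sideLength ρ (n + 1) → ∀ Φ : Literature.MathematicalPhysics.QuantumManyBody.BoseGas.Config (n + 1) → ℂ, (Measurable Φ ∧ (∀ X, X ∉ Literature.MathematicalPhysics.QuantumManyBody.BoseGas.boxN (n + 1) L → Φ X = 0) ∧ (∫⁻ X, (‖Φ X‖₊ : ENNReal) ^ 2) = 1 ∧ Literature.MathematicalPhysics.QuantumManyBody.BoseGas.groundStateEnergy v (n + 1) L ≠ ⊤ ∧ ∃ Ψ : ℕ → Literature.MathematicalPhysics.QuantumManyBody.BoseGas.TrialState (n + 1) L, Filter.Tendsto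 (fun k => Literature.MathematicalPhysics.QuantumManyBody.BoseGas.energy v (Ψ k)) Filter.atTop (nhds (Literature.MathematicalPhysics.QuantumManyBody.BoseGas.groundStateEnergy v (n + 1) L)) ∧ Filter.Tendsto (fun k => ∫⁻ X, (‖(Ψ k).ψ X - Φ X‖₊ : ENNReal) ^ 2) Filter.atTop (nhds 0)) → ∃ Θ : Literature.MathematicalPhysics.QuantumManyBody.BoseGas.Config (n + 1) → ℂ, (Measurable Θ ∧ (∫⁻ X in Literature.MathematicalPhysics.QuantumManyBody.BoseGas.cellN (n + 1) L, (‖Θ X‖₊ : ENNReal) ^ 2) = 1 ∧ Literature.MathematicalPhysics.QuantumManyBody.BoseGas.periodicGroundStateEnergy v (n + 1) L ≠ ⊤ ∧ ∃ Ψ : ℕ → Literature.MathematicalPhysics.QuantumManyBody.BoseGas.PeriodicTrialState (n + 1) L, Filter.Tendsto (fun k => Literature.MathematicalPhysics.QuantumManyBody.BoseGas.periodicEnergy v (Ψ k)) Filter.atTop (nhds (Literature.MathematicalPhysics.QuantumManyBody.BoseGas.periodicGroundStateEnergy v (n + 1) L)) ∧ Filter.Tendsto (fun k => ∫⁻ X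 in Literature.MathematicalPhysics.QuantumManyBody.BoseGas.cellN (n + 1) L, (‖(Ψ k).ψ X - Θ X‖₊ : ENNReal) ^ 2) Filter.atTop (nhds 0)) ∧ (∀ ρΦ : Literature.MathematicalPhysics.QuantumManyBody.BoseGas.Space → ENNReal, ρΦ = (fun x => ((n : ENNReal) + 1) * ∫⁻ Y : Literature.MathematicalPhysics.QuantumManyBody.BoseGas.Config n, (‖Φ (Matrix.vecCons x Y)‖₊ : ENNReal) ^ 2) → ∀ b : Literature.MathematicalPhysics.QuantumManyBody.BoseGas.Space → Literature.MathematicalPhysics.QuantumManyBody.BoseGas.Space → ENNReal, b = (fun x y => ENNReal.ofReal (L ^ 3) * ∫⁻ Y : Literature.MathematicalPhysics.QuantumManyBody.BoseGas.Config n, (((Literature.MathematicalPhysics.QuantumManyBody.BoseGas.cellN (n + 1) L).indicator (fun X => (‖Θ X‖₊ : ENNReal) ^ 2) (Matrix.vecCons x Y)) * ((Literature.MathematicalPhysics.QuantumManyBody.BoseGas.cellN (n + 1) L).indicator (fun X => (‖Θ X‖₊ : ENNReal) ^ 2) (Matrix.vecCons y Y))) ^ ((1 : ℝ) / 2)) →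 ENNReal.ofReal c * ((n : ENNReal) + 1) * (∫⁻ x in Literature.MathematicalPhysics.QuantumManyBody.BoseGas.cell L, ρΦ x) ^ 2 ≤ ((n : ENNReal) + 1) * ∫⁻ x : Literature.MathematicalPhysics.QuantumManyBody.BoseGas.Space, ∫⁻ y : Literature.MathematicalPhysics.QuantumManyBody.BoseGas.Space, ρΦ x * ρΦ y * b x y)

/-- item stmt-AtomisticToContinuum-12181 · support · rank 9 · open · by planner
sources: ReedSimonIV1978, LSSY2005, LiebSeiringer2002
[support] (per potential) for every repulsive finite-range v: if there are ρ₀ and, for ρ<ρ₀, some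
c>0 such that for all large N = n+1 every Dirichlet ground state Φ (as in TiltCommutation) has Q(Φ)
= ∫dY(∫√ρ_Φ(x)|Φ(x,Y)|dx)² ≥ cN, then ∃ρ₀'>0 ∀ρ∈(0,ρ₀') HasGroundStateBEC v ρ. Proof: shrink ρ₀ so
that E₀(N,L) < ∞ eventually (bumps); if condensateNumber < (c/2)N for some large N, then for every
δ>0 some δ-near-minimiser has maxOccupation < (c/2)N; a minimising sequence of such states converges
in L² (Rellich, H¹₀ of the box) to a ground state Φ; uniqueness/positivity of the Dirichlet ground
state (Perron–Frobenius / Beurling–Deny for −Δ+V on the connected admissible region, Reed–Simon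
XIII.47; hard cores: connectedness of the hard-sphere configuration space at low density) makes
Φ(·,Y) of constant phase, so the occupation of the FIXED normalised mode u = √(ρ_Φ/N) in Ψ_k tends
to N∫|∫ūΦ|² = Q(Φ) ≥ cN — contradiction; finish with occupation_le_maxOccupation and
le_condensateNumber. All near-minimiser/compactness/phase plumbing of the variational conjunct is
paid here, once. [difficulty: L] -/
@[route_item "route-AtomisticToContinuum-BECDistantTilts", crux]
def GroundStateReduction : Prop :=
  ∀ v : ℝ → ENNReal, Literature.MathematicalPhysics.QuantumManyBody.BoseGas.IsRepulsiveFiniteRange v → (∃ ρ₀ : ℝ, 0 < ρ₀ ∧ ∀ ρ : ℝ, 0 < ρ → ρ < ρ₀ → ∃ c : ℝ, 0 < c ∧ ∀ᶠ n : ℕ in Filter.atTop, ∀ L : ℝ, L = Literature.MathematicalPhysics.QuantumManyBody.BoseGas.sideLength ρ (n + 1) → ∀ Φ : Literature.MathematicalPhysics.QuantumManyBody.BoseGas.Config (n + 1) → ℂ, (Measurable Φ ∧ (∀ X, X ∉ Literature.MathematicalPhysics.QuantumManyBody.BoseGas.boxN (n + 1) L → Φ X = 0) ∧ (∫⁻ X,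 (‖Φ X‖₊ : ENNReal) ^ 2) = 1 ∧ Literature.MathematicalPhysics.QuantumManyBody.BoseGas.groundStateEnergy v (n + 1) L ≠ ⊤ ∧ ∃ Ψ : ℕ → Literature.MathematicalPhysics.QuantumManyBody.BoseGas.TrialState (n + 1) L, Filter.Tendsto (fun k => Literature.MathematicalPhysics.QuantumManyBody.BoseGas.energy v (Ψ k)) Filter.atTop (nhds (Literature.MathematicalPhysics.QuantumManyBody.BoseGas.groundStateEnergy v (n + 1) L)) ∧ Filter.Tendsto (fun k => ∫⁻ X, (‖(Ψ k).ψ X - Φ X‖₊ : ENNReal) ^ 2) Filter.atTop (nhds 0)) → ∀ ρΦ : Literature.MathematicalPhysics.QuantumManyBody.BoseGas.Space → ENNReal, ρΦ = (fun x => ((n : ENNReal) + 1) * ∫⁻ Y : Literature.MathematicalPhysics.QuantumManyBody.BoseGas.Config n, (‖Φ (Matrix.vecCons x Y)‖₊ : ENNReal) ^ 2) → ENNReal.ofReal (c * ((n : ℝ) + 1)) ≤ ∫⁻ Y : Literature.MathematicalPhysics.QuantumManyBody.BoseGas.Config n, (∫⁻ x : Literature.MathematicalPhysics.QuantumManyBody.BoseGas.Space,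 (ρΦ x) ^ ((1 : ℝ) / 2) * (‖Φ (Matrix.vecCons x Y)‖₊ : ENNReal)) ^ 2) → ∃ ρ₀ : ℝ, 0 < ρ₀ ∧ ∀ ρ : ℝ, 0 < ρ → ρ < ρ₀ → Literature.MathematicalPhysics.QuantumManyBody.BoseGas.HasGroundStateBEC v ρ

/-- item stmt-AtomisticToContinuum-12182 · assembly · rank 1 · open · by planner
sources: LSSY2005, PenroseOnsager1956
[assembly] TiltCommutation → BulkIndistinguishability → PeriodicBEC → PairAlgebra → TorusAveraging →
GroundStateReduction → BoseEinsteinCondensation (the sub-problem Statement decl). -/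
@[route_item "route-AtomisticToContinuum-BECDistantTilts"]
def Assembly : Prop :=
  TiltCommutation → BulkIndistinguishability → PeriodicBEC → PairAlgebra → TorusAveraging → GroundStateReduction → BoseEinsteinCondensation

/-! D-0027 §2.1 — DECIDING THEOREM (planner-authored via `route open/edit --closes-file`; by planner-plancard-AtomisticToContinuum-BoseEin-03930835-g2-0 2026-08-15T18:50:51Z):
its hypotheses are this route's items and its conclusion the sub-problem Statement (glue_lint), and it elaborates with this file. -/

@[closes "route-AtomisticToContinuum-BECDistantTilts"] theorem closes (h₁ : TiltCommutation) (h₂ : BulkIndistinguishability) (h₃ : PeriodicBEC) (h₄ : PairAlgebra)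
    (h₅ : TorusAveraging) (h₆ : GroundStateReduction) : BoseEinsteinCondensation := by
  intro v hv
  apply h₆ v hv
  obtain ⟨ρ₁, hρ₁, H₁⟩ := h₁ v hv
  obtain ⟨ρ₂, hρ₂, H₂⟩ := h₂ v hv
  obtain ⟨ρ₃, hρ₃, H₃⟩ := h₅ v hv (h₃ v hv)
  refine ⟨min ρ₁ (min ρ₂ ρ₃), lt_min hρ₁ (lt_min hρ₂ hρ₃), fun ρ hρ hρlt => ?_⟩
  have hρ1 : ρ < ρ₁ := lt_of_lt_of_le hρlt (min_le_left _ _)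
  have hρ2 : ρ < ρ₂ := lt_of_lt_of_le hρlt ((min_le_right _ _).trans (min_le_left _ _))
  have hρ3 : ρ < ρ₃ := lt_of_lt_of_le hρlt ((min_le_right _ _).trans (min_le_right _ _))
  obtain ⟨c, hc, H₃'⟩ := H₃ ρ hρ hρ3
  -- c' = min c 1, tolerance η = (c'/16)², final constant c'/2
  obtain ⟨c', hc'pos, hc'le1, hc'lec⟩ : ∃ c' : ℝ, 0 < c' ∧ c' ≤ 1 ∧ c' ≤ c :=
    ⟨min c 1, lt_min hc one_pos, min_le_right _ _, min_le_left _ _⟩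
  have hηpos : (0 : ℝ) < (c' / 16) ^ 2 := by positivity
  have hsqrt : Real.sqrt ((c' / 16) ^ 2) = c' / 16 := Real.sqrt_sq (by positivity)
  have hkey : c' / 2 ≤ c - 4 * (c' / 16) ^ 2 - 4 * Real.sqrt ((c' / 16) ^ 2) := by
    rw [hsqrt]; nlinarith [hc'pos, hc'le1, hc'lec]
  refine ⟨c' / 2, by positivity, ?_⟩
  filter_upwards [H₁ ρ hρ hρ1 _ hηpos, H₂ ρ hρ hρ2 _ hηpos, H₃'] with n hn₁ hn₂ hn₃
  intro L hL Φ hΦ ρΦ hρΦ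
  obtain ⟨Θ, hΘ, hcoh⟩ := hn₃ L hL Φ hΦ
  have i₁ := hn₁ L hL Φ hΦ Θ hΘ ρΦ hρΦ _ rfl _ rfl _ rfl
  have i₂ := hn₂ L hL Φ hΦ Θ hΘ ρΦ hρΦ _ rfl _ rfl _ rfl _ rfl
  have i₃ := hcoh ρΦ hρΦ _ rfl
  have key := h₄ n L _ c Φ Θ hηpos.le hΦ.1 hΘ.1 hΦ.2.1 hΦ.2.2.1 ρΦ hρΦ _ rfl _ rfl _ rfl _ rfl i₁ i₂ i₃
  refine le_trans (ENNReal.ofReal_le_ofReal ?_) key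
  have hn0 : (0 : ℝ) ≤ (n : ℝ) + 1 := by positivity
  exact mul_le_mul_of_nonneg_right hkey hn0

end Summit.AtomisticToContinuum.BoseEinsteinCondensation.Theses.BECDistantTilts
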